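import Summits.BirchSwinnertonDyer.BirchSwinnertonDyer.Theorems.ManinLocalTwoThreeEtaIdentitiesOneHundredEight
import Summits.BirchSwinnertonDyer.BirchSwinnertonDyer.Theorems.ManinLocalTwoThreeNeronSqueeze
import Summits.BirchSwinnertonDyer.Rank1Residual.Additive.IntModelConductorCertificate
import Summits.BirchSwinnertonDyer.BirchSwinnertonDyer.Theorems.SignedLowerHalvesKobayashiMainConjectureSmallImageCMTransferRecordsF
import HarnessLib

/-!
# Level 108 (`27 ∣ 108`, `4 ∣ 108`): the Néron squeeze for `108a1 = [0, 0, 0, 0, 4]` — `|c| = 1` for every `X₀(108)`-datum whose newform is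
# `φ₁₀₈ = −2B₁ + 2B₂ + B₃ + 6B₄ + 6B₅`; `N(108a1) = 108` in the kernel; the C2/C3 bodies at `108` MODULO THE NEWFORM PINNING

Cell bsd-f2-manin, route `ManinLocalTwoThree` (cruxes C2 `ManinOddAtFour` stmt-22967 AND C3 `ManinPrimeToThreeAtNine` stmt-22968;
`108 = 2²·3³` is the first treated level of the charter's `27 ∣ N` cell), prover seat p3 gen 24; level-`108` instance of the general
NÉRON SQUEEZE (`NeronSqueeze.abs_maninConstant_eq_one_of_periodLattice_le`) fed with (S2)₁₀₈ `Λ(φ₁₀₈) ⊆ Λ(0, −16)` of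
`EtaIdentitiesOneHundredEight` (UNCONDITIONAL, E₂ road).

* §1 `108a1 = [0, 0, 0, 0, 4] : y² = x³ + 4` (elliptic and globally minimal by the tree's CM records, `isElliptic_cm0p4`,
  `isGloballyMinimal_cm0p4`), **`N(108a1) = 108`** by kernel Tate certificates
  (type `IV*` at `2`: `(r, s, t) = (0, 0, 2)` to `[0, 0, 4, 0, 0]`, exit `8`, `f₂ = 8 + 1 − 7 = 2`; type `II` at `3`: `(r, s, t) = (−1, 0, 0)` to
  `[0, −3, 0, 3, 3]`, `3 ∥ a₆`, `f₃ = 3 + 1 − 1 = 3`), Néron invariants `(c₄/12, c₆/216) = (0, −16)`;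
* §2 **`abs_maninConstant_eq_one_oneHundredEight_of_f_eq`**: for every globally minimal elliptic `W/ℚ` and every `X₀(108)`-datum `D` of `W` with
  the lattice clause AND `⇑D.f = φ₁₀₈`: `|c(D)| = 1`, hence `2 ∤ c` and `3 ∤ c`;
* §3 MODULO THE PINNING `hpin : ∀ W D, ⇑D.f = φ₁₀₈` (an-g51's exclusion certificate T-an-g51-108 on the 10-dimensional
  `S₂(Γ₀(108))` — a concrete finite statement, NOT proved here, NOT a named fact): the C2 and C3 bodies at `N = 108` for every datum,
  and the domain is inhabited GIVEN `exists_isNewformOf` (the items' binder).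

HONEST FRAMING: §1–§2 unconditional (standard axioms); §3 conditional on `hpin` (and `exists_isNewformOf` for inhabitation).  The `∀ N`
cruxes C2/C3, Manin's conjecture and BSD are NOT proved; items 22967/22968 stay OPEN as filed.  No definition, no named fact, no sorry.
[cite: AgasheRibetStein2006, §§1–2] [cite: CremonaAlgorithms1997, Table 1 (108a1)] [cite: Silverman1994, IV.9.4 and IV.11.1]
[cite: EdixhovenManin1991, Prop. 2] [cite: DiamondShurman2005, Thm. 8.8.3]
-/

set_option autoImplicit false
-- lint-debt: the directory name repeats the summit name (sibling precedent `ManinLocalTwoThreeNeronSqueezeSixtyFour.lean`)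
set_option linter.dupNamespace false

noncomputable section

open Complex Filter Topology Set Function
open UpperHalfPlane hiding I
open scoped Real Topology Manifold MatrixGroups ModularForm
open ModularForm CongruenceSubgroup WeierstrassCurve
open Summit.BirchSwinnertonDyer.BirchSwinnertonDyer.Rank2Observatory
open Summit.BirchSwinnertonDyer.BirchSwinnertonDyer.Rank2Observatory.RootNumber
open Summit.BirchSwinnertonDyer.BirchSwinnertonDyer.Rank2Observatory.Tate
open Summit.BirchSwinnertonDyer.Rank1Residual.Additive
open Literature.NumberTheory.EllipticCurves Literature.NumberTheory.EllipticCurves.ModularForms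
open Literature.NumberTheory.Automorphic

namespace Summit.BirchSwinnertonDyer.BirchSwinnertonDyer.Theorems.ManinLocalTwoThree.NeronSqueezeOneHundredEight

open EtaIdentitiesOneHundredEight

/-! ## §1 `108a1 = [0, 0, 0, 0, 4]`: elliptic, minimal, conductor `108`, Néron invariants `(0, −16)` -/

/-- The literal `ℚ`-model `[0, 0, 0, 0, 4]` read through integer casts. [folklore] -/
theorem mk_oneHundredEightA1_eq_cast :
    (⟨0, 0, 0, 0, 4⟩ : WeierstrassCurve ℚ) = ⟨((0 : ℤ) : ℚ), ((0 : ℤ) : ℚ), ((0 : ℤ) : ℚ), ((0 : ℤ) : ℚ), ((4 : ℤ) : ℚ)⟩ := by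
  ext <;> norm_num

-- `108a1` is elliptic and globally minimal in the tree already: `isElliptic_cm0p4`, `isGloballyMinimal_cm0p4`
-- (`SignedLowerHalvesKobayashiMainConjectureSmallImageCMTransferRecordsF`, the CM partner `y² = x³ + 4`).

/-- **`N([0, 0, 0, 0, 4]) = 108 = 2²·3³`**: deep Tate certificate at `2` (`(r, s, t) = (0, 0, 2)` to `[0, 0, 4, 0, 0]`, exit `IV*`: `4 ∣ a₂, a₃`, `8 ∣ a₄`,
`16 ∣ a₆`, `2 ∤ (a₃/4)² + 4(a₆/16) = 1`; `f₂ = 2`) and Step-3 certificate at `3` (`(r, s, t) = (−1, 0, 0)` to `[0, −3, 0, 3, 3]`, `3 ∥ a₆`: type `II`,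
`f₃ = 3`); no other bad prime; all kernel-checked, minimality included. [cite: Silverman1994, IV.9.4 and IV.11.1] [cite: CremonaAlgorithms1997, Table 1 (108a1)] -/
theorem conductorNorm_oneHundredEightA1 : (⟨0, 0, 0, 0, 4⟩ : WeierstrassCurve ℚ).conductorNorm ℤ = 108 := by
  rw [mk_oneHundredEightA1_eq_cast]
  exact IntModelCond.conductorNorm_mk_eq_of_certs_of_eq 0 0 0 0 4
    (cm := ⟨8, 0, 7, [⟨3, 1, 3, 2, 0⟩]⟩) (c := ⟨8, 0, 7, 3, 0, 3, []⟩)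
    (l₂ := ⟨3, 0, 0, 2, 8, 8, 0⟩) (l₃ := ⟨2, -1, 0, 0, 3, 2, 0⟩)
    (by decide +kernel) (by decide +kernel) (by decide +kernel) (by decide +kernel) (by decide +kernel)

/-- `2² ∣ 108` and `3² ∣ 108` (indeed `3³ ∣ 108`): the level lies in both crux domains. [folklore] -/
theorem sq_dvd_oneHundredEight : 2 ^ 2 ∣ 108 ∧ 3 ^ 2 ∣ 108 := ⟨⟨27, by norm_num⟩, ⟨12, by norm_num⟩⟩

/-- **The Néron invariants of `108a1`**: `c₄ = 0`, `c₆ = −3456`; the direction used: `(g₂, g₃) = (0, −16) ⟹ IsNeronLatticeOf`.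
[cite: CremonaAlgorithms1997, Table 1 (108a1)] -/
theorem isNeronLatticeOf_oneHundredEightA1 {L₁ : PeriodPair} (hg2 : L₁.g₂ = 0) (hg3 : L₁.g₃ = -16) :
    IsNeronLatticeOf ((⟨0, 0, 0, 0, 4⟩ : WeierstrassCurve ℚ).baseChange ℂ) L₁ := by
  constructor
  · rw [hg2]
    norm_num [WeierstrassCurve.baseChange, WeierstrassCurve.map_c₄, WeierstrassCurve.c₄,
      WeierstrassCurve.b₂, WeierstrassCurve.b₄]
  · rw [hg3]
    norm_num [WeierstrassCurve.baseChange, WeierstrassCurve.map_c₆, WeierstrassCurve.c₆,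
      WeierstrassCurve.b₂, WeierstrassCurve.b₄, WeierstrassCurve.b₆]

/-! ## §2 The squeeze: `|c| = 1` for every `X₀(108)`-datum with `⇑D.f = φ₁₀₈`, unconditionally -/

/-- **`|c| = 1` for every `X₀(108)`-datum whose newform is `φ₁₀₈`** (pointwise form of the pinning as hypothesis): (S2)₁₀₈ + the general
Néron squeeze with `W₀ = 108a1`. [cite: AgasheRibetStein2006, §§1–2] -/
theorem abs_maninConstant_eq_one_oneHundredEight_of_f_eq (W : WeierstrassCurve ℚ) [W.IsElliptic] [W.IsGloballyMinimal]
    (D : ModularParametrizationData W 108)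
    (hf : ⇑D.f = fun τ ↦ (-2 * etaQuotient 108 (expFn [(6, 1), (18, 2), (36, -2), (54, -3), (108, 6)]) τ + 2 * etaQuotient 108 (expFn [(6, 1), (9, 1), (18, -1), (27, -3), (54, 6)]) τ + etaQuotient 108 (expFn [(6, 1), (9, 2), (18, -4), (27, -6), (36, 2), (54, 15), (108, -6)]) τ + 6 * etaQuotient 108 (expFn [(6, 2), (12, -2), (18, -2), (36, 6)]) τ + 6 * etaQuotient 108 (expFn [(6, 1), (18, 1), (36, -1), (108, 3)]) τ))
    (hopt : ∀ z ∈ D.L.lattice, ∃ w ∈ periodLattice D.f, z = D.c * w) :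
    |D.maninConstant| = 1 := by
  haveI := isElliptic_cm0p4
  haveI := isGloballyMinimal_cm0p4
  obtain ⟨L₁, hg2, hg3, hle⟩ := periodLatticeLe_oneHundredEight D.f hf
  exact NeronSqueeze.abs_maninConstant_eq_one_of_periodLattice_le (⟨0, 0, 0, 0, 4⟩ : WeierstrassCurve ℚ) L₁
    (isNeronLatticeOf_oneHundredEightA1 hg2 hg3) W D hle hopt

/-- `2 ∤ c` and `3 ∤ c` for every `X₀(108)`-datum whose newform is `φ₁₀₈` — UNCONDITIONAL. [folklore] -/
theorem not_dvd_maninConstant_oneHundredEight_of_f_eq (W : WeierstrassCurve ℚ) [W.IsElliptic] [W.IsGloballyMinimal]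
    (D : ModularParametrizationData W 108)
    (hf : ⇑D.f = fun τ ↦ (-2 * etaQuotient 108 (expFn [(6, 1), (18, 2), (36, -2), (54, -3), (108, 6)]) τ + 2 * etaQuotient 108 (expFn [(6, 1), (9, 1), (18, -1), (27, -3), (54, 6)]) τ + etaQuotient 108 (expFn [(6, 1), (9, 2), (18, -4), (27, -6), (36, 2), (54, 15), (108, -6)]) τ + 6 * etaQuotient 108 (expFn [(6, 2), (12, -2), (18, -2), (36, 6)]) τ + 6 * etaQuotient 108 (expFn [(6, 1), (18, 1), (36, -1), (108, 3)]) τ))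
    (hopt : ∀ z ∈ D.L.lattice, ∃ w ∈ periodLattice D.f, z = D.c * w) :
    ¬ (2 : ℤ) ∣ D.maninConstant ∧ ¬ (3 : ℤ) ∣ D.maninConstant := by
  have h := abs_maninConstant_eq_one_oneHundredEight_of_f_eq W D hf hopt
  refine ⟨fun h2 ↦ ?_, fun h3 ↦ ?_⟩
  · have := Int.le_of_dvd (by rw [h]; norm_num) ((dvd_abs _ _).mpr h2)
    rw [h] at this
    norm_num at this
  · have := Int.le_of_dvd (by rw [h]; norm_num) ((dvd_abs _ _).mpr h3)
    rw [h] at this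
    norm_num at this

/-! ## §3 Modulo the pinning: C2 and C3 at `N = 108` for every datum; inhabitation under the items' binder -/

/-- **C2/C3 at `N = 108` for EVERY datum, MODULO THE PINNING `hpin`** (every `X₀(108)`-datum has newform `φ₁₀₈` — a finite-dimensional
statement about `S₂(Γ₀(108))`, an-g51's exclusion certificate, taken as hypothesis): `|c| = 1`, `2 ∤ c`, `3 ∤ c` with none of the items'
fact hypotheses. [cite: AgasheRibetStein2006, §§1–2] -/
theorem maninConstant_oneHundredEight_of_pinning
    (hpin : ∀ (W : WeierstrassCurve ℚ) [W.IsElliptic] (D : ModularParametrizationData W 108),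
      ⇑D.f = fun τ ↦ (-2 * etaQuotient 108 (expFn [(6, 1), (18, 2), (36, -2), (54, -3), (108, 6)]) τ + 2 * etaQuotient 108 (expFn [(6, 1), (9, 1), (18, -1), (27, -3), (54, 6)]) τ + etaQuotient 108 (expFn [(6, 1), (9, 2), (18, -4), (27, -6), (36, 2), (54, 15), (108, -6)]) τ + 6 * etaQuotient 108 (expFn [(6, 2), (12, -2), (18, -2), (36, 6)]) τ + 6 * etaQuotient 108 (expFn [(6, 1), (18, 1), (36, -1), (108, 3)]) τ))
    (W : WeierstrassCurve ℚ) [W.IsElliptic] [W.IsGloballyMinimal] (D : ModularParametrizationData W 108)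
    (hopt : ∀ z ∈ D.L.lattice, ∃ w ∈ periodLattice D.f, z = D.c * w) :
    |D.maninConstant| = 1 ∧ ¬ (2 : ℤ) ∣ D.maninConstant ∧ ¬ (3 : ℤ) ∣ D.maninConstant :=
  ⟨abs_maninConstant_eq_one_oneHundredEight_of_f_eq W D (hpin W D) hopt,
    not_dvd_maninConstant_oneHundredEight_of_f_eq W D (hpin W D) hopt⟩

/-- **Modularity at `108a1`, levelled**: under `exists_isNewformOf` the curve `[0, 0, 0, 0, 4]` has a newform in `S₂(Γ₀(108))` (its conductor IS
`108`).  CONDITIONAL on the items' own binder. [cite: DiamondShurman2005, Thm. 8.8.3] -/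
theorem exists_isNewformOf_oneHundredEightA1 (hnf : exists_isNewformOf) :
    ∃ f : CuspForm (Gamma0 108) 2, IsNewformOf (⟨0, 0, 0, 0, 4⟩ : WeierstrassCurve ℚ) f := by
  haveI := isElliptic_cm0p4
  have key : ∀ (N : ℕ) [NeZero N], (⟨0, 0, 0, 0, 4⟩ : WeierstrassCurve ℚ).conductorNorm ℤ = N →
      ∃ f : CuspForm (Gamma0 N) 2, IsNewformOf (⟨0, 0, 0, 0, 4⟩ : WeierstrassCurve ℚ) f := by
    intro N _ hN
    subst hN
    exact hnf _
  haveI : NeZero (108 : ℕ) := ⟨by decide⟩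
  exact key 108 conductorNorm_oneHundredEightA1

/-- **A lattice-optimal `X₀(108)`-datum on a globally minimal curve of the class `108a` exists under modularity** — the `X₀(108)`-domain of
C2/C3 is inhabited relative to the items' hypotheses.  CONDITIONAL on `exists_isNewformOf` only.
[cite: EdixhovenManin1991, Prop. 2] [cite: DiamondShurman2005, Thm. 8.8.3] -/
theorem domain_inhabited_oneHundredEight_of_modularity (hnf : exists_isNewformOf) :
    ∃ (W₀ : WeierstrassCurve ℚ) (_ : W₀.IsElliptic) (_ : W₀.IsGloballyMinimal) (D₀ : ModularParametrizationData W₀ 108),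
      (⟨0, 0, 0, 0, 4⟩ : WeierstrassCurve ℚ).IsIsogenous W₀ ∧ (∀ z ∈ D₀.L.lattice, ∃ w ∈ periodLattice D₀.f, z = D₀.c * w) ∧ 2 ^ 2 ∣ 108 ∧ 3 ^ 2 ∣ 108 := by
  haveI := isElliptic_cm0p4
  haveI : NeZero (108 : ℕ) := ⟨by decide⟩
  obtain ⟨f, hf⟩ := exists_isNewformOf_oneHundredEightA1 hnf
  obtain ⟨D⟩ := nonempty_modularParametrizationData_of_isNewformOf hf
  obtain ⟨W₀, h₀, hmin, D₀, -, hiso, hopt, -⟩ := ExistsMinimalOptimalDatum.existsMinimalOptimalDatum_full (⟨0, 0, 0, 0, 4⟩ : WeierstrassCurve ℚ) D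
  exact ⟨W₀, h₀, hmin, D₀, hiso, hopt, sq_dvd_oneHundredEight⟩

end Summit.BirchSwinnertonDyer.BirchSwinnertonDyer.Theorems.ManinLocalTwoThree.NeronSqueezeOneHundredEight

end
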